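/-
Copyright: the b2b-balaban T⁴-continuum CRUX team, row NE7b OWNER lineage `t4-ne7b-p1` (gen 143). Project licence.
-/
import Summits.QuantumFields.BalabanUV.T4Continuum.Spine.NE7b.SupWhitenedHessHessGradCumulantRaw
import Summits.QuantumFields.BalabanUV.T4Continuum.Spine.NE7b.SupWhitenedMixedThirdCumulantEntry

/-!
# THE MIXED ENTRY `κ₃(U″e_xe_y, U″e_ze_t, U′e_s)` HAS TREE DECAY ROOTED AT `x`, GENERAL `Γ = AAᵀ`, ANY ADMISSIBLE `D` (SCOPING (d14)(2)(iv); two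
# Hessian vertices, the vectors `g^{xy}` weighted at `x` and `g^{zt}` at `z`).  From (569)'s forms (the second-Hessian form is the first with the
# pairs exchanged), (466)'s decay and (463)'s tree lemma at the triangle `x, z, s`:
#   `|E_ν(G_{xy} − EG)(G_{zt} − EG)(F_s − EF_s)| ≤ 4√(MK)∕(ρ_{xz}ρ_{xs})`,  `M = 5(κ₂⁴+κ₃⁴)γ_op²∕(1−λγ_op)²`, `K = αθ·dθ·(βθ·dθ′)∕(1−lamA)`
# — NO dependence on the background; also in tilted form under `N(0,AAᵀ)` (row NE7b, node U5c; (463), (466), (569) BY NAME; [folklore])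

Cell `pub-balaban`, sub-cell `t4`, spine estimate NE7b (`T4WeightBudget.RelWeightBound`; the cell's OWN estimate — NOT PRINTED in
[Bałaban 1983–89], NOT PROVED).  Crux-route work under `Spine/NE7b/` by the row OWNER (`t4-ne7b-p1` gen 143, file (570)) under FREEZE
(0)'s crux-prover clause; NOTHING of Bałaban's is named as a Lean object, valued or asserted; no `T4Continuum/Support` leaf typed; no
`def`, no notation (everything WRITTEN OUT); zero `sorry`.  Imports (BY NAME):
the OWNER's (569) `…SupWhitenedHessHessGradCumulantRaw` (the forms; through it (566) `whitened_observable_bridge`),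
(508) `…SupWhitenedMixedThirdCumulantEntry` (for (466) `cross_bilinear_decay`, (463) `distinguished_bound`, `tree_bound`, (457), (456)).

WHAT IS PROVED ([folklore]): §1 **`whitened_hesshess_grad_entry_raw`**; §2 THE END **`whitened_hesshess_grad_entry`**; §3 toy.

HONEST (what this is NOT).  One placement (`x` inside a Hessian pair); the placement `x` = the gradient slot is the next
file; the row letters (support-counted
tree sums), the `κ₄(U″,U′,U′,U′)` piece and the FORM of `∂⁵W` are NOT
typed.  Scalar skeleton ((A3), NC-NE7b-α UNRULED); nothing of Bałaban's asserted.  BY-NAME EFFECT ON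
THE WALL: NONE.  NE7b NOT PRINTED ∕ NOT PROVED; spine PROVED 0∕9; rung (B)+1 — the programme's measures remain FINITE-torus statements; NOT
the mass gap, NOT Clay.  HONEST DEPENDENCY: continuum YM on T⁴ ⇐ BetaPertH ∧ nine spine estimates (0∕9 proved); BetaPertH ⇐ (D1) ∧ (D4) ∧
CAP+tail; G-an2-4 gates asym, D1 and NE2∕3∕4.
-/

set_option autoImplicit false
set_option maxSynthPendingDepth 3

noncomputable section

namespace Summit.QuantumFields.BalabanUV.T4Continuum.NE7b.SupWhitenedHessHessGradCumulantEntry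

open MeasureTheory ProbabilityTheory Real Set Function Finset Matrix
open scoped BigOperators
open Literature.Probability.Distributions (matrixCLM)
open SupCrossWeightedCovarianceDecay (cross_bilinear_decay)
open SupThirdCumulantTreeDecay (distinguished_bound tree_bound)
open SupWhitenedFirstOrderLetters (whitened_cross_nonneg whitened_obs_nonneg whitened_J_rowsum_le)
open SupWhitenedCovarianceKernelLetter (whitened_tilted_eq_gauss whitened_integral_eq)
open SupWhitenedMomentLetters (op_letter_nonneg)

open SupWhitenedHessHessGradCumulantRaw (whitened_hesshess_grad_cumulant_hess_raw whitened_hesshess_grad_cumulant_grad_raw)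
open SupWhitenedThirdGradGradCumulantRaw (whitened_observable_bridge)

variable {ι κ : Type} [Fintype ι] [DecidableEq ι] [Fintype κ] [DecidableEq κ]

variable {U : EuclideanSpace ℝ ι → ℝ} {U' : EuclideanSpace ℝ ι → EuclideanSpace ℝ ι →L[ℝ] ℝ}
  {U'' : EuclideanSpace ℝ ι → EuclideanSpace ℝ ι →L[ℝ] EuclideanSpace ℝ ι →L[ℝ] ℝ}
  {U₃ : EuclideanSpace ℝ ι → EuclideanSpace ℝ ι →L[ℝ] EuclideanSpace ℝ ι →L[ℝ] EuclideanSpace ℝ ι →L[ℝ] ℝ}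
  {U₄ : EuclideanSpace ℝ ι → EuclideanSpace ℝ ι →L[ℝ] EuclideanSpace ℝ ι →L[ℝ] EuclideanSpace ℝ ι →L[ℝ] EuclideanSpace ℝ ι →L[ℝ] ℝ}
  {Hk : ι → ι → ℝ} {K3 : ι → ι → ι → ℝ} {K4 : ι → ι → ι → ι → ℝ} {A : Matrix ι κ ℝ} {D : κ → κ → ℝ}
  {γop κ₀ κ₁ κ₂ κ₃ κ₄ a τ δ θp lam lamA αr αc hr γ dθ dθ' αθ βθ : ℝ} {θ : κ → κ → ℝ} {σ : ι → κ → ℝ} {ρ : ι → ι → ℝ}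

/-! ## §1. The raw entry (whitened Lebesgue tilted format) -/

/-- **THE ENTRY (whitened Lebesgue tilted format)**: the display `≤ 4√(MK)∕(ρ_{xz}ρ_{xs})`. [folklore] -/
theorem whitened_hesshess_grad_entry_raw [Nonempty κ] (hΓop : (γop • (1 : Matrix ι ι ℝ) - A * Aᵀ).PosSemidef) (Y : Finset ι)
    (hUd : ∀ φ : EuclideanSpace ℝ ι, HasFDerivAt U (U' φ) φ) (hU'd : ∀ φ : EuclideanSpace ℝ ι, HasFDerivAt U' (U'' φ) φ)
    (hU''d : ∀ φ : EuclideanSpace ℝ ι, HasFDerivAt U'' (U₃ φ) φ) (hU₃c : Continuous U₃)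
    (hκ₀ : 0 ≤ κ₀) (hκ₁ : 0 ≤ κ₁) (ha : 0 ≤ a) (hτ : 0 < τ) (hδ : 0 < δ) (hθ0 : 0 < θp) (hθ1 : θp < 1) (hκθ : (2 * κ₀ * (1 + τ) + 4 * δ) * γop ≤ θp)
    (hκθw : 2 * κ₀ * (1 + τ) * γop + 4 * δ ≤ θp) (hstab : ∀ φ : EuclideanSpace ℝ ι, -(κ₀ * ∑ x ∈ Y, φ x ^ 2) ≤ U φ)
    (hU'b : ∀ φ : EuclideanSpace ℝ ι, ‖U' φ‖ ≤ κ₁ * (a + ∑ x ∈ Y, φ x ^ 2)) (hU''b : ∀ φ : EuclideanSpace ℝ ι, ‖U'' φ‖ ≤ κ₂)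
    (hU₃b : ∀ φ : EuclideanSpace ℝ ι, ‖U₃ φ‖ ≤ κ₃) (hlam : 0 ≤ lam)
    (hUsec : ∀ s : ℝ, 0 ≤ s → s ≤ 1 → ∀ a b : EuclideanSpace ℝ ι,
      U ((1 - s) • a + s • b) - lam / 2 * (s * (1 - s)) * ∑ i, (a i - b i) ^ 2 ≤ (1 - s) * U a + s * U b)
    (hρg : lam * γop < 1)
    (hHk : ∀ (φ : EuclideanSpace ℝ ι) (x z : ι), |U'' φ (EuclideanSpace.single z (1 : ℝ)) (EuclideanSpace.single x (1 : ℝ))| ≤ Hk x z)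
    (hHk0 : ∀ v u, 0 ≤ Hk v u)
    (hK3 : ∀ (φ : EuclideanSpace ℝ ι) (u x y : ι),
      |U₃ φ (EuclideanSpace.single u (1 : ℝ)) (EuclideanSpace.single x (1 : ℝ)) (EuclideanSpace.single y (1 : ℝ))| ≤ K3 x y u) (ψ : EuclideanSpace ℝ
          ι) (hK30 : ∀ x y u, 0 ≤ K3 x y u)
    (hαr : ∀ u, ∑ w, |A u w| ≤ αr) (hαc : ∀ w, ∑ u, |A u w| ≤ αc) (hhr : ∀ v, ∑ u, Hk v u ≤ hr)
    (hlamA : ∀ x : κ, ∑ u, ∑ v, |A u x| * |A v x| * Hk v u ≤ lamA) (hlamA1 : lamA < 1) (hγ : αc * hr * αr / (1 - lamA) ≤ γ) (hγ1 : γ < 1)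
    -- the admissible `D` and its weighted letters
    (hD : ∀ x y, 0 ≤ D x y)
    (hDC : ∀ x y, (if x = y then (1 : ℝ) else 0) + ∑ z, D x z * ((if y = z then 0 else ∑ u, ∑ v, |A u y| * |A v z| * Hk v u) / (1 - lamA)) ≤ D x y)
    (hθnn : ∀ z w, 0 ≤ θ z w) (hDr : ∀ z, ∑ w, D z w * θ z w ≤ dθ) (hdθ : 0 ≤ dθ) (hDc : ∀ w, ∑ z, D z w * θ z w ≤ dθ') (hdθ' : 0 ≤ dθ')
    -- the weights and the weighted profiles (gradient vectors at their sites, the vertex vectors at their FIRST site)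
    (hσ0 : ∀ x w, 0 ≤ σ x w) (hσθ : ∀ x z w, σ x w ≤ σ x z * θ z w)
    (hρ1 : ∀ x y, 1 ≤ ρ x y) (hρsymm : ∀ x y, ρ x y = ρ y x) (hρmul : ∀ x y z, ρ x z ≤ ρ x y * ρ y z) (hρσ : ∀ x y w, ρ x y ^ 8 ≤ σ x w * σ y w)
    (haσ : ∀ v : ι, ∑ w, (∑ u, |A u w| * Hk v u) * σ v w ≤ αθ) (hβ : 0 ≤ βθ) (haσ' : ∀ (v : ι) (w : κ), (∑ u, |A u w| * Hk v u) * σ v w ≤ βθ)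
    (hgσ : ∀ p q : ι, ∑ w, (∑ u, |A u w| * K3 p q u) * σ p w ≤ αθ) (hgσ' : ∀ (p q : ι) (w : κ), (∑ u, |A u w| * K3 p q u) * σ p w ≤ βθ)
    (x y z t s : ι) :
    |∫ w, (U'' (matrixCLM A (WithLp.toLp 2 w) + ψ) (EuclideanSpace.single x (1 : ℝ)) (EuclideanSpace.single y (1 : ℝ)) -
            ∫ w', U'' (matrixCLM A (WithLp.toLp 2 w') + ψ) (EuclideanSpace.single x (1 : ℝ)) (EuclideanSpace.single y (1 : ℝ))
              ∂((volume : Measure (κ → ℝ)).tilted fun z => -(1 / 2 * (z ⬝ᵥ z) + U (matrixCLM A (WithLp.toLp 2 z) + ψ)))) *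
          (U'' (matrixCLM A (WithLp.toLp 2 w) + ψ) (EuclideanSpace.single z (1 : ℝ)) (EuclideanSpace.single t (1 : ℝ)) -
            ∫ w', U'' (matrixCLM A (WithLp.toLp 2 w') + ψ) (EuclideanSpace.single z (1 : ℝ)) (EuclideanSpace.single t (1 : ℝ))
              ∂((volume : Measure (κ → ℝ)).tilted fun z => -(1 / 2 * (z ⬝ᵥ z) + U (matrixCLM A (WithLp.toLp 2 z) + ψ)))) *
          (U' (matrixCLM A (WithLp.toLp 2 w) + ψ) (EuclideanSpace.single s (1 : ℝ)) -
            ∫ w', U' (matrixCLM A (WithLp.toLp 2 w') + ψ) (EuclideanSpace.single s (1 : ℝ))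
              ∂((volume : Measure (κ → ℝ)).tilted fun z => -(1 / 2 * (z ⬝ᵥ z) + U (matrixCLM A (WithLp.toLp 2 z) + ψ))))
        ∂((volume : Measure (κ → ℝ)).tilted fun z => -(1 / 2 * (z ⬝ᵥ z) + U (matrixCLM A (WithLp.toLp 2 z) + ψ)))| ≤
      4 * Real.sqrt ((5 * ((κ₂ ^ 4 + κ₃ ^ 4) * γop ^ 2) / (1 - lam * γop) ^ 2) * (αθ * dθ * (βθ * dθ') / (1 - lamA))) / (ρ x z * ρ x s) := by
  obtain ⟨w₀⟩ := ‹Nonempty κ›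
  haveI : Nonempty ι := ⟨x⟩
  have hl1 : 0 < 1 - lamA := by linarith
  have hγop := op_letter_nonneg hΓop
  -- Dobrushin's plain row condition from the letters
  have hrow : ∀ x : κ, ∑ w, (if w = x then 0 else ∑ u, ∑ v, |A u w| * |A v x| * Hk v u) / (1 - lamA) ≤ γ := fun x => by
    rw [← Finset.sum_div]
    refine le_trans (div_le_div_of_nonneg_right ?_ hl1.le) hγ
    refine le_trans (Finset.sum_le_sum fun w _ => ?_) (whitened_J_rowsum_le hHk0 hαr hαc hhr x)
    split_ifs
    · exact le_rfl
    · linarith [abs_nonneg ((1 : Matrix κ κ ℝ) x w)]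
  have hγ0 : 0 ≤ γ := by
    refine le_trans (Finset.sum_nonneg fun w _ => div_nonneg ?_ hl1.le) (hrow w₀)
    split_ifs
    · exact le_rfl
    · exact whitened_cross_nonneg hHk0 A w₀ w
  have hαθ : 0 ≤ αθ := le_trans (Finset.sum_nonneg fun w _ => mul_nonneg (whitened_obs_nonneg hHk0 A x w) (hσ0 x w)) (haσ x)
  have hK : 0 ≤ (αθ * dθ * (βθ * dθ') / (1 - lamA)) := by positivity
  have hM : 0 ≤ (5 * ((κ₂ ^ 4 + κ₃ ^ 4) * γop ^ 2) / (1 - lam * γop) ^ 2) := by positivity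
  have hgnn : ∀ (p q : ι) (w : κ), 0 ≤ ∑ u, |A u w| * K3 p q u := fun p q w => Finset.sum_nonneg fun u _ => mul_nonneg (abs_nonneg _) (hK30 p q u)
  -- Step 1: the decay of `B` for the ordered pairs of vectors ((466))
  have hB12 : ∑ w, (∑ z', D z' w * ∑ u, |A u z'| * K3 x y u) * (∑ z', D z' w * ∑ u, |A u z'| * K3 z t u) / (1 - lamA) ≤
      (αθ * dθ * (βθ * dθ') / (1 - lamA)) / ρ x z ^ 8 := by
    have h := cross_bilinear_decay (D := D) (θ := θ) (σ := σ) (ρ := fun x y => ρ x y ^ 8) (c := fun _ => 1 - lamA)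
      (a := fun w => ∑ u, |A u w| * K3 x y u) (b := fun w => ∑ u, |A u w| * K3 z t u) hD hθnn hσ0 hσθ (fun x y w => hρσ x y w)
      (fun x y => one_le_pow₀ (hρ1 x y)) hDr hdθ hDc hdθ' hl1 (fun _ => le_rfl) (fun w => hgnn x y w) (fun w => hgnn z t w) x z (hgσ x y) hβ
      (hgσ' z t)
    rw [div_mul_eq_div_div] at h
    exact h
  have hB13 : ∑ w, (∑ z', D z' w * ∑ u, |A u z'| * K3 x y u) * (∑ z', D z' w * ∑ u, |A u z'| * Hk s u) / (1 - lamA) ≤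
      (αθ * dθ * (βθ * dθ') / (1 - lamA)) / ρ x s ^ 8 := by
    have h := cross_bilinear_decay (D := D) (θ := θ) (σ := σ) (ρ := fun x y => ρ x y ^ 8) (c := fun _ => 1 - lamA)
      (a := fun w => ∑ u, |A u w| * K3 x y u) (b := fun w => ∑ u, |A u w| * Hk s u) hD hθnn hσ0 hσθ (fun x y w => hρσ x y w)
      (fun x y => one_le_pow₀ (hρ1 x y)) hDr hdθ hDc hdθ' hl1 (fun _ => le_rfl) (fun w => hgnn x y w) (fun w => whitened_obs_nonneg hHk0 A s w) x s
          (hgσ x y) hβ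
      (haσ' s)
    rw [div_mul_eq_div_div] at h
    exact h
  have hB21 : ∑ w, (∑ z', D z' w * ∑ u, |A u z'| * K3 z t u) * (∑ z', D z' w * ∑ u, |A u z'| * K3 x y u) / (1 - lamA) ≤
      (αθ * dθ * (βθ * dθ') / (1 - lamA)) / ρ z x ^ 8 := by
    have h := cross_bilinear_decay (D := D) (θ := θ) (σ := σ) (ρ := fun x y => ρ x y ^ 8) (c := fun _ => 1 - lamA)
      (a := fun w => ∑ u, |A u w| * K3 z t u) (b := fun w => ∑ u, |A u w| * K3 x y u) hD hθnn hσ0 hσθ (fun x y w => hρσ x y w)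
      (fun x y => one_le_pow₀ (hρ1 x y)) hDr hdθ hDc hdθ' hl1 (fun _ => le_rfl) (fun w => hgnn z t w) (fun w => hgnn x y w) z x (hgσ z t) hβ
      (hgσ' x y)
    rw [div_mul_eq_div_div] at h
    exact h
  have hB23 : ∑ w, (∑ z', D z' w * ∑ u, |A u z'| * K3 z t u) * (∑ z', D z' w * ∑ u, |A u z'| * Hk s u) / (1 - lamA) ≤
      (αθ * dθ * (βθ * dθ') / (1 - lamA)) / ρ z s ^ 8 := by
    have h := cross_bilinear_decay (D := D) (θ := θ) (σ := σ) (ρ := fun x y => ρ x y ^ 8) (c := fun _ => 1 - lamA)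
      (a := fun w => ∑ u, |A u w| * K3 z t u) (b := fun w => ∑ u, |A u w| * Hk s u) hD hθnn hσ0 hσθ (fun x y w => hρσ x y w)
      (fun x y => one_le_pow₀ (hρ1 x y)) hDr hdθ hDc hdθ' hl1 (fun _ => le_rfl) (fun w => hgnn z t w) (fun w => whitened_obs_nonneg hHk0 A s w) z s
          (hgσ z t) hβ
      (haσ' s)
    rw [div_mul_eq_div_div] at h
    exact h
  have hB31 : ∑ w, (∑ z', D z' w * ∑ u, |A u z'| * Hk s u) * (∑ z', D z' w * ∑ u, |A u z'| * K3 x y u) / (1 - lamA) ≤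
      (αθ * dθ * (βθ * dθ') / (1 - lamA)) / ρ s x ^ 8 := by
    have h := cross_bilinear_decay (D := D) (θ := θ) (σ := σ) (ρ := fun x y => ρ x y ^ 8) (c := fun _ => 1 - lamA)
      (a := fun w => ∑ u, |A u w| * Hk s u) (b := fun w => ∑ u, |A u w| * K3 x y u) hD hθnn hσ0 hσθ (fun x y w => hρσ x y w)
      (fun x y => one_le_pow₀ (hρ1 x y)) hDr hdθ hDc hdθ' hl1 (fun _ => le_rfl) (fun w => whitened_obs_nonneg hHk0 A s w) (fun w => hgnn x y w) s x
          (haσ s) hβ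
      (hgσ' x y)
    rw [div_mul_eq_div_div] at h
    exact h
  have hB32 : ∑ w, (∑ z', D z' w * ∑ u, |A u z'| * Hk s u) * (∑ z', D z' w * ∑ u, |A u z'| * K3 z t u) / (1 - lamA) ≤
      (αθ * dθ * (βθ * dθ') / (1 - lamA)) / ρ s z ^ 8 := by
    have h := cross_bilinear_decay (D := D) (θ := θ) (σ := σ) (ρ := fun x y => ρ x y ^ 8) (c := fun _ => 1 - lamA)
      (a := fun w => ∑ u, |A u w| * Hk s u) (b := fun w => ∑ u, |A u w| * K3 z t u) hD hθnn hσ0 hσθ (fun x y w => hρσ x y w)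
      (fun x y => one_le_pow₀ (hρ1 x y)) hDr hdθ hDc hdθ' hl1 (fun _ => le_rfl) (fun w => whitened_obs_nonneg hHk0 A s w) (fun w => hgnn z t w) s z
          (haσ s) hβ
      (hgσ' z t)
    rw [div_mul_eq_div_div] at h
    exact h
  -- Step 2: the distinguished forms and the splits `Σ_w P(Q+R)/c = B + B`
  have hF1 := whitened_hesshess_grad_cumulant_hess_raw hΓop Y hUd hU'd hU''d hU₃c hκ₀ hκ₁ ha hτ hδ hθ0 hθ1 hκθ hκθw hstab hU'b hU''b hU₃b hlam hUsec
      hρg hHk hHk0 hK3 ψ hlamA hlamA1 hrow hγ0 hγ1 hD hDC x y z t s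
  have hF2 := whitened_hesshess_grad_cumulant_hess_raw hΓop Y hUd hU'd hU''d hU₃c hκ₀ hκ₁ ha hτ hδ hθ0 hθ1 hκθ hκθw hstab hU'b hU''b hU₃b hlam hUsec
      hρg hHk hHk0 hK3 ψ hlamA hlamA1 hrow hγ0 hγ1 hD hDC z t x y s
  have hF3 := whitened_hesshess_grad_cumulant_grad_raw hΓop Y hUd hU'd hU''d hU₃c hκ₀ hκ₁ ha hτ hδ hθ0 hθ1 hκθ hκθw hstab hU'b hU''b hU₃b hlam hUsec
      hρg hHk hHk0 hK3 ψ hlamA hlamA1 hrow hγ0 hγ1 hD hDC x y z t s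
  have hsplit : ∀ P Q R : κ → ℝ, ∑ w, P w * (Q w + R w) / (1 - lamA) = ∑ w, P w * Q w / (1 - lamA) + ∑ w, P w * R w / (1 - lamA) :=
    fun P Q R => by
      rw [← Finset.sum_add_distrib]
      exact Finset.sum_congr rfl fun w _ => by ring
  have hsplit' : ∀ P Q R : κ → ℝ, ∑ w, P w * (Q w + R w) / (1 - lamA) = ∑ w, P w * R w / (1 - lamA) + ∑ w, P w * Q w / (1 - lamA) :=
    fun P Q R => by rw [hsplit, add_comm]
  have hreshape : ∀ (T S B₁ B₂ : ℝ), S = B₁ + B₂ → T ≤ 2 * Real.sqrt (2 * S * (5 * ((κ₂ ^ 4 + κ₃ ^ 4) * γop ^ 2) / (1 - lam * γop) ^ 2)) → T ≤ 2 *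
      Real.sqrt (2 * (5 * ((κ₂ ^ 4 + κ₃ ^ 4) * γop ^ 2) / (1 - lam * γop) ^ 2) * (B₁ + B₂)) :=
    fun T S B₁ B₂ hS h => by
      rw [hS, show 2 * (B₁ + B₂) * (5 * ((κ₂ ^ 4 + κ₃ ^ 4) * γop ^ 2) / (1 - lam * γop) ^ 2) = 2 * (5 * ((κ₂ ^ 4 + κ₃ ^ 4) * γop ^ 2) / (1 - lam *
          γop) ^ 2) * (B₁ + B₂) from by ring] at h
      exact h
  -- Step 3: the distinguished bounds ((463) `distinguished_bound`)
  have d1 := distinguished_bound hM hK (hρ1 x z) (hρ1 x s) hB12 hB13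
    (hreshape _ _ _ _ (hsplit (fun w => (∑ z', D z' w * ∑ u, |A u z'| * K3 x y u)) (fun w => (∑ z', D z' w * ∑ u, |A u z'| * K3 z t u))
      (fun w => (∑ z', D z' w * ∑ u, |A u z'| * Hk s u))) hF1)
  have d2 := distinguished_bound hM hK (hρ1 z x) (hρ1 z s) hB21 hB23
    (hreshape _ _ _ _ (hsplit (fun w => (∑ z', D z' w * ∑ u, |A u z'| * K3 z t u)) (fun w => (∑ z', D z' w * ∑ u, |A u z'| * K3 x y u))
      (fun w => (∑ z', D z' w * ∑ u, |A u z'| * Hk s u))) hF2)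
  have d3 := distinguished_bound hM hK (hρ1 s x) (hρ1 s z) hB31 hB32
    (hreshape _ _ _ _ (hsplit (fun w => (∑ z', D z' w * ∑ u, |A u z'| * Hk s u)) (fun w => (∑ z', D z' w * ∑ u, |A u z'| * K3 x y u))
      (fun w => (∑ z', D z' w * ∑ u, |A u z'| * K3 z t u))) hF3)
  -- Step 4: the tree bound at the triangle `x, z, s` (integrands commuted)
  have hC : 0 ≤ 4 * Real.sqrt ((5 * ((κ₂ ^ 4 + κ₃ ^ 4) * γop ^ 2) / (1 - lam * γop) ^ 2) * (αθ * dθ * (βθ * dθ') / (1 - lamA))) := by positivity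
  have hqpr : ρ x s ≤ ρ x z * ρ z s := hρmul x z s
  have hpqr : ρ x z ≤ ρ x s * ρ s z := hρmul x s z
  rw [hρsymm s z] at hpqr
  rw [hρsymm z x] at d2
  rw [hρsymm s x, hρsymm s z] at d3
  refine tree_bound hC (hρ1 x z) (hρ1 x s) (hρ1 z s) hqpr hpqr ?_ ?_ ?_
  · exact d1
  · refine le_trans (le_of_eq ?_) d2
    congr 1
    exact integral_congr_ae (ae_of_all _ fun w => by ring)
  · refine le_trans (le_of_eq ?_) d3
    congr 1
    exact integral_congr_ae (ae_of_all _ fun w => by ring)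

/-! ## §2. THE END under `N(0, AAᵀ)` -/

/-- **THE ENTRY UNDER `N(0,AAᵀ)`** (tilted form, Gaussian centring constants): the display `≤ 4√(MK)∕(ρ_{xz}ρ_{xs})`. [folklore] -/
theorem whitened_hesshess_grad_entry [Nonempty κ] (hΓop : (γop • (1 : Matrix ι ι ℝ) - A * Aᵀ).PosSemidef) (Y : Finset ι)
    (hUd : ∀ φ : EuclideanSpace ℝ ι, HasFDerivAt U (U' φ) φ) (hU'd : ∀ φ : EuclideanSpace ℝ ι, HasFDerivAt U' (U'' φ) φ)
    (hU''d : ∀ φ : EuclideanSpace ℝ ι, HasFDerivAt U'' (U₃ φ) φ) (hU₃c : Continuous U₃)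
    (hκ₀ : 0 ≤ κ₀) (hκ₁ : 0 ≤ κ₁) (ha : 0 ≤ a) (hτ : 0 < τ) (hδ : 0 < δ) (hθ0 : 0 < θp) (hθ1 : θp < 1) (hκθ : (2 * κ₀ * (1 + τ) + 4 * δ) * γop ≤ θp)
    (hκθw : 2 * κ₀ * (1 + τ) * γop + 4 * δ ≤ θp) (hstab : ∀ φ : EuclideanSpace ℝ ι, -(κ₀ * ∑ x ∈ Y, φ x ^ 2) ≤ U φ)
    (hU'b : ∀ φ : EuclideanSpace ℝ ι, ‖U' φ‖ ≤ κ₁ * (a + ∑ x ∈ Y, φ x ^ 2)) (hU''b : ∀ φ : EuclideanSpace ℝ ι, ‖U'' φ‖ ≤ κ₂)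
    (hU₃b : ∀ φ : EuclideanSpace ℝ ι, ‖U₃ φ‖ ≤ κ₃) (hlam : 0 ≤ lam)
    (hUsec : ∀ s : ℝ, 0 ≤ s → s ≤ 1 → ∀ a b : EuclideanSpace ℝ ι,
      U ((1 - s) • a + s • b) - lam / 2 * (s * (1 - s)) * ∑ i, (a i - b i) ^ 2 ≤ (1 - s) * U a + s * U b)
    (hρg : lam * γop < 1)
    (hHk : ∀ (φ : EuclideanSpace ℝ ι) (x z : ι), |U'' φ (EuclideanSpace.single z (1 : ℝ)) (EuclideanSpace.single x (1 : ℝ))| ≤ Hk x z)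
    (hHk0 : ∀ v u, 0 ≤ Hk v u)
    (hK3 : ∀ (φ : EuclideanSpace ℝ ι) (u x y : ι),
      |U₃ φ (EuclideanSpace.single u (1 : ℝ)) (EuclideanSpace.single x (1 : ℝ)) (EuclideanSpace.single y (1 : ℝ))| ≤ K3 x y u) (ψ : EuclideanSpace ℝ
          ι) (hK30 : ∀ x y u, 0 ≤ K3 x y u)
    (hαr : ∀ u, ∑ w, |A u w| ≤ αr) (hαc : ∀ w, ∑ u, |A u w| ≤ αc) (hhr : ∀ v, ∑ u, Hk v u ≤ hr)
    (hlamA : ∀ x : κ, ∑ u, ∑ v, |A u x| * |A v x| * Hk v u ≤ lamA) (hlamA1 : lamA < 1) (hγ : αc * hr * αr / (1 - lamA) ≤ γ) (hγ1 : γ < 1)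
    -- the admissible `D` and its weighted letters
    (hD : ∀ x y, 0 ≤ D x y)
    (hDC : ∀ x y, (if x = y then (1 : ℝ) else 0) + ∑ z, D x z * ((if y = z then 0 else ∑ u, ∑ v, |A u y| * |A v z| * Hk v u) / (1 - lamA)) ≤ D x y)
    (hθnn : ∀ z w, 0 ≤ θ z w) (hDr : ∀ z, ∑ w, D z w * θ z w ≤ dθ) (hdθ : 0 ≤ dθ) (hDc : ∀ w, ∑ z, D z w * θ z w ≤ dθ') (hdθ' : 0 ≤ dθ')
    -- the weights and the weighted profiles (gradient vectors at their sites, the vertex vectors at their FIRST site)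
    (hσ0 : ∀ x w, 0 ≤ σ x w) (hσθ : ∀ x z w, σ x w ≤ σ x z * θ z w)
    (hρ1 : ∀ x y, 1 ≤ ρ x y) (hρsymm : ∀ x y, ρ x y = ρ y x) (hρmul : ∀ x y z, ρ x z ≤ ρ x y * ρ y z) (hρσ : ∀ x y w, ρ x y ^ 8 ≤ σ x w * σ y w)
    (haσ : ∀ v : ι, ∑ w, (∑ u, |A u w| * Hk v u) * σ v w ≤ αθ) (hβ : 0 ≤ βθ) (haσ' : ∀ (v : ι) (w : κ), (∑ u, |A u w| * Hk v u) * σ v w ≤ βθ)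
    (hgσ : ∀ p q : ι, ∑ w, (∑ u, |A u w| * K3 p q u) * σ p w ≤ αθ) (hgσ' : ∀ (p q : ι) (w : κ), (∑ u, |A u w| * K3 p q u) * σ p w ≤ βθ)
    (x y z t s : ι) :
    |(∫ ω : EuclideanSpace ℝ ι, exp (-U (ω + ψ)) ∂(multivariateGaussian 0 (A * Aᵀ)))⁻¹ * (∫ ω : EuclideanSpace ℝ ι, exp (-U (ω + ψ)) *
        ((U'' (ω + ψ) (EuclideanSpace.single x (1 : ℝ)) (EuclideanSpace.single y (1 : ℝ)) - ((∫ ω : EuclideanSpace ℝ ι, exp (-U (ω + ψ))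
            ∂(multivariateGaussian 0 (A * Aᵀ)))⁻¹ *
            (∫ ω : EuclideanSpace ℝ ι, exp (-U (ω + ψ)) * U'' (ω + ψ) (EuclideanSpace.single x (1 : ℝ)) (EuclideanSpace.single y (1 : ℝ))
                ∂(multivariateGaussian 0 (A * Aᵀ))))) *
          (U'' (ω + ψ) (EuclideanSpace.single z (1 : ℝ)) (EuclideanSpace.single t (1 : ℝ)) - ((∫ ω : EuclideanSpace ℝ ι, exp (-U (ω + ψ))
              ∂(multivariateGaussian 0 (A * Aᵀ)))⁻¹ *
            (∫ ω : EuclideanSpace ℝ ι, exp (-U (ω + ψ)) * U'' (ω + ψ) (EuclideanSpace.single z (1 : ℝ)) (EuclideanSpace.single t (1 : ℝ))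
                ∂(multivariateGaussian 0 (A * Aᵀ))))) *
          (U' (ω + ψ) (EuclideanSpace.single s (1 : ℝ)) - ((∫ ω : EuclideanSpace ℝ ι, exp (-U (ω + ψ)) ∂(multivariateGaussian 0 (A * Aᵀ)))⁻¹ *
            (∫ ω : EuclideanSpace ℝ ι, exp (-U (ω + ψ)) * U' (ω + ψ) (EuclideanSpace.single s (1 : ℝ)) ∂(multivariateGaussian 0 (A * Aᵀ))))))
        ∂(multivariateGaussian 0 (A * Aᵀ)))| ≤
      4 * Real.sqrt ((5 * ((κ₂ ^ 4 + κ₃ ^ 4) * γop ^ 2) / (1 - lam * γop) ^ 2) * (αθ * dθ * (βθ * dθ') / (1 - lamA))) / (ρ x z * ρ x s) := by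
  have hUc : Continuous U := continuous_iff_continuousAt.2 fun φ => (hUd φ).continuousAt
  have hU'c : Continuous U' := continuous_iff_continuousAt.2 fun φ => (hU'd φ).continuousAt
  have hU''c : Continuous U'' := continuous_iff_continuousAt.2 fun φ => (hU''d φ).continuousAt
  have h := whitened_hesshess_grad_entry_raw hΓop Y hUd hU'd hU''d hU₃c hκ₀ hκ₁ ha hτ hδ hθ0 hθ1 hκθ hκθw hstab hU'b hU''b hU₃b hlam hUsec hρg hHk
      hHk0 hK3 ψ hK30 hαr hαc hhr hlamA hlamA1 hγ hγ1 hD hDC hθnn hDr hdθ hDc hdθ' hσ0 hσθ hρ1 hρsymm hρmul hρσ haσ hβ haσ' hgσ hgσ' x y z t s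
  have hm1 := whitened_observable_bridge (U := U) hUc A ψ (p := fun φ => U'' φ (EuclideanSpace.single x (1 : ℝ)) (EuclideanSpace.single y (1 : ℝ)))
      ((hU''c.clm_apply continuous_const).clm_apply continuous_const)
  beta_reduce at hm1
  have hm2 := whitened_observable_bridge (U := U) hUc A ψ (p := fun φ => U'' φ (EuclideanSpace.single z (1 : ℝ)) (EuclideanSpace.single t (1 : ℝ)))
      ((hU''c.clm_apply continuous_const).clm_apply continuous_const)
  beta_reduce at hm2
  have hm3 := whitened_observable_bridge (U := U) hUc A ψ (p := fun φ => U' φ (EuclideanSpace.single s (1 : ℝ))) (hU'c.clm_apply continuous_const)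
  beta_reduce at hm3
  rw [hm1, hm2, hm3] at h
  have htr := whitened_observable_bridge (U := U) hUc A ψ (p := (fun φ => (U'' φ (EuclideanSpace.single x (1 : ℝ)) (EuclideanSpace.single y (1 : ℝ))
      - ((∫ ω : EuclideanSpace ℝ ι, exp (-U (ω + ψ)) ∂(multivariateGaussian 0 (A * Aᵀ)))⁻¹ *
            (∫ ω : EuclideanSpace ℝ ι, exp (-U (ω + ψ)) * U'' (ω + ψ) (EuclideanSpace.single x (1 : ℝ)) (EuclideanSpace.single y (1 : ℝ))
                ∂(multivariateGaussian 0 (A * Aᵀ))))) * (U'' φ (EuclideanSpace.single z (1 : ℝ)) (EuclideanSpace.single t (1 : ℝ)) - ((∫ ω :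
                EuclideanSpace ℝ ι, exp (-U (ω + ψ)) ∂(multivariateGaussian 0 (A * Aᵀ)))⁻¹ *
            (∫ ω : EuclideanSpace ℝ ι, exp (-U (ω + ψ)) * U'' (ω + ψ) (EuclideanSpace.single z (1 : ℝ)) (EuclideanSpace.single t (1 : ℝ))
                ∂(multivariateGaussian 0 (A * Aᵀ))))) * (U' φ (EuclideanSpace.single s (1 : ℝ)) - ((∫ ω : EuclideanSpace ℝ ι, exp (-U (ω + ψ))
                ∂(multivariateGaussian 0 (A * Aᵀ)))⁻¹ *
            (∫ ω : EuclideanSpace ℝ ι, exp (-U (ω + ψ)) * U' (ω + ψ) (EuclideanSpace.single s (1 : ℝ)) ∂(multivariateGaussian 0 (A * Aᵀ)))))))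
    (((((hU''c.clm_apply continuous_const).clm_apply continuous_const).sub continuous_const).mul (((hU''c.clm_apply continuous_const).clm_apply
        continuous_const).sub continuous_const)).mul ((hU'c.clm_apply continuous_const).sub continuous_const))
  beta_reduce at htr
  rw [htr] at h
  exact h

/-! ## §3. Toy -/

/-- Toy (the common moment letter dominates each vertex letter): `5a ≤ 5(a+b)` for `b ≥ 0`. -/
example (a b : ℝ) (hb : 0 ≤ b) : 5 * a ≤ 5 * (a + b) := by linarith

end Summit.QuantumFields.BalabanUV.T4Continuum.NE7b.SupWhitenedHessHessGradCumulantEntry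

end
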